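import Summits.QuantumFields.YangMills.Theorems.BalabanUVNodesN12AtRecord13OfResiduals
import Literature.MathematicalPhysics.QuantumFieldTheory.Balaban1983to89.Node00.N24ItemsStage13SepCoP
import Literature.MathematicalPhysics.QuantumFieldTheory.Balaban1983to89.B16RLeafRecord13LiveCoP

/-!
# BalabanUVNodes ∕ N12 — THE v3 RUNG BODY `NodesAtSomeRecord13PW` OF ITEM K1⁵ (plan g69 K1SKEL-V3, 2026-08-27T11:26Z: N08 AND N12 PINNED BY NAME — the `rBasicStep` leaf IS [IV]'s basic step AT NODE 00's
# BUNDLE OF RECORD `WOfRecord₁₃ θ λ P` on every run with steps) OVER THE GENERIC-`W₀` FOUR-PIN VIEW, N12 (MIXED W-PIN) AND N13 (dag-n11-e's v1.5 live chain) RESOLVED, the v3 conjunct witnessed by THIS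
# SEAT's OWN [IV] LAYER `λ` — at the live re-pin of any `Θ` carrying node00-def-K0b's residuals and at the plan's witness `θ₁₅ᶜ` (sequel of 12R `BalabanUVNodesN12AtRecord13SepCoPSockets` p526070, whose v2
# body it extends by one conjunct; Track A, DAG node N12 = [B15, Balaban1989LargeFieldI] CMP **122** (1989) 175–202; cluster K1 (K1⁵ `StabilityBAtRecordR13SepCoP` = stmt-QuantumFields-20294, stubs v3
# `stub_nodes13PW` ∕ `stub_betaWindow13PW`); seat `pub-ymgap-dag-n12-d` g10 (R134 s2), 2026-08-27; count-neutral, NOT a discharge)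

HONEST FRAMING.  Count-neutral kernel COMPOSITION BY NAME over dag-n24-c's v1.5 four-pin ∕ thin modules (`N24_nodes₁₃B10YZW₀_pointed_coP`, `N24_isRecordOfRecord₁₃CSepCoP_of_up_pinB10YZW₀`), node00-def-K0a's
live re-pin and guard (`liveRepin₁₃`, `slotsNondegenerate₁₃_liveRepin_of_hasResiduals`, `admissible_theta13OfNumerics`, `hasResidualsOfRecord_theta13OfNumerics`), K0b's `HasResidualsOfRecord.ztUnity`,
dag-n11-e's `B16RLeafRecord13LiveCoP.laws₁₃CoP_liveRepin₁₃_of_hasResiduals` + the θ₁₅ᶜ signs, this seat's 12E (`b15Leaf_WOfRecord₁₃_liveRepin₁₃_of_massLive_of_hasResiduals`) and pub-ymgap-plan g69's probe term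
(`D69-K1V3/v3_socket_probe.lean` (i)).  WHICH CHILD BLOCKS at this socket = its hypothesis list, nothing hidden: K0⁵'s `hP : Provisos₁₃SepCoP (Θ.liveRepin₁₃)`; the world binding `hC hγ hL hup` at the W₀
four-pin view; rows h05–h10; `h11` (S1ᵀ) `SLaw₁₃CoP → TLaw₁₃CoP` (its satisfiability at `k = 0` is NOT asserted here — director-ym №169 (iii): the N11 `k = 0` clause is where no pen sinks work; v1.6
`CoPR` re-keys it); `hUV`; the mixed W-pin data `W₀ hW hWdeg` AND NOW the selector bound `hsel : ∀ P, 1 ≤ P.K → λ.kSel P < P.K` (so `hWdeg` fires only at `K = 0`); N12's per-run displays below the torus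
((1.100) pin equation, live-mass — NODE 00 —, Proposition 1 — dag-n12-c's letters via 12Q′ —, (1.80), (1.89) — dag-n12-e's pins ∕ N07-at-objects); signs; nothing of Bałaban's is asserted; N12 is NOT
discharged; no node is discharged; counts unmoved (Track A discharged 5∕28).  Under director-ym №174 (v1.6 → rev 22) this file ports 1:1 to `SepCoPR` by plan's token map T₆ (`WOfRecord₁₃` unchanged).
ONE finite four-torus programme at fixed `ε = L^{-K}` — nothing continuum ∕ ℝ⁴ ∕ OS ∕ mass gap ∕ Clay.
-/

noncomputable section

open MeasureTheory
open scoped Matrix.Norms.L2Operator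

namespace Summit.QuantumFields.YangMills.BalabanUVNodes.N12AtRecord13SepCoPSocketsPW

open Literature.MathematicalPhysics.QuantumFieldTheory.Balaban1983to89
open Literature.MathematicalPhysics.QuantumFieldTheory.Balaban1983to89.T4Continuum (T4Family)
open Literature.MathematicalPhysics.QuantumFieldTheory.Balaban1983to89.DagBinding
open Literature.MathematicalPhysics.QuantumFieldTheory.Balaban1983to89.Node00
open FlowStep (BetaLowerH BetaUpperH)
open FlowStepRuns (genFlow)
open B15Claim189Assembly (new189 chiPP dom)
open B15 (Prop1Printed Ineq180)
open B15.BasicStep (Claim189)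
open B8Eq17ClassAkV1 (plaqsOf)
open B15RPrime1100OfRep (rPrimeDataOfSel)
open B16RLeafRecord13LiveRstep (kappa_nonneg_theta13OfThm1C E0_nonneg_theta13OfThm1C B0_nonneg_theta13OfThm1C)
open B16RLeafRecord13LiveCoP (laws₁₃CoP_liveRepin₁₃_of_hasResiduals)
open Summit.QuantumFields.YangMills.BalabanUVNodes.N12AtRecord13OfResiduals (b15Leaf_WOfRecord₁₃_liveRepin₁₃_of_massLive_of_hasResiduals)

variable {N : ℕ} [NeZero N] {F : T4Family}

/-! ## §1. Generic `Θ` carrying K0b's residuals, at the live re-pin `Θ.liveRepin₁₃` -/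

section Live
variable (Θ : Stage13Params F N) (lamW : ResidW F N)

/-- **★★ THE BODY OF K1⁵'s REGISTERED RUNG v3 `NodesAtSomeRecord13PW` (plan g69 K1SKEL-V3: N08 AND N12 PINNED BY NAME) OVER THE GENERIC-`W₀` FOUR-PIN VIEW OF THE LIVE RE-PIN, N12 AND N13
RESOLVED** — the v2 body exactly as in 12R (`N24_nodes₁₃B10YZW₀_pointed_coP` + `N24_isRecordOfRecord₁₃CSepCoP_of_up_pinB10YZW₀` at `θ := Θ.liveRepin₁₃`; guard from K0b's `hres`, admissibility transported,
N12's `h12` by the MIXED W-PIN through 12E's row, N13's (R₁₃CoP) row by dag-n11-e's `laws₁₃CoP_liveRepin₁₃_of_hasResiduals`) AND the v3 conjunct WITNESSED BY THIS SEAT's OWN LAYER `λ := lamW`: the selector bound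
`hsel : ∀ P, 1 ≤ P.K → lamW.kSel P < P.K` (displayed — WHICH step per run stays `ResidW.kSel`'s located question) and, below the torus, `(leavesP w P).rBasicStep ↔ B15Leaf (WOfRecord₁₃ F N (Θ.liveRepin₁₃ F N) lamW P)`
by the world binding `hup` and the mixed pin `hW` (plan's probe term: `rw [← hW P hk]; show (w.up P).rBasicStep ↔ _; rw [hup P]; exact Iff.rfl`).  With `hsel` the degenerate branch `hWdeg` of the mixed pin
fires only on `K = 0` runs: N12's per-run displays `h12pin ∕ h12mass ∕ h12P1 ∕ h12i180 ∕ h12c189` are owed at one genuine step of EVERY run with steps.  At `N := 2` the conclusion is the registered text of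
`stub_nodes13PW`'s consequent verbatim.  COMPOSITE: nothing is discharged as a node. [cite: Balaban1989LargeFieldII, Thm 1 p.355, (0.1) pp.355–356, p.391; Balaban1989LargeFieldI, (0.1) p.175, (0.2)–(0.6) p.176, p.177 (i)–(ii), Prop. 1 (1.78) p.194, (1.80) p.195, (1.89) p.198, (1.99)–(1.102) pp.200–201; Balaban1988Convergent, p.244, (3.16)–(3.25) pp.268–270; Balaban1985UV3, Thm 1 p.257, Thm 2 p.272 (bookkeeping)] -/
theorem nodesAtSomeRecord₁₃SepCoPPW_of_fourPinW₀_liveRepin₁₃_of_massLive_of_hasResiduals (hres : Θ.HasResidualsOfRecord F N) (hP : (Θ.liveRepin₁₃ F N).Provisos₁₃SepCoP F N) (hθ : Θ.Admissible F N)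
    (hκ : 0 ≤ Θ.s2.lf.κ) (hE₀ : 0 ≤ Θ.s2.lf.E₀) (hB₀ : 0 ≤ Θ.s2.lf.B₀)
    (Mstar : ℕ) (ops : OpsY N (Θ.liveRepin₁₃ F N).toStage3Params Mstar) (ζ : ResidZ F N) (W₀ : B12.RunParams → PrintedCarriers15) (w : WorldP)
    -- the generic [IV] carrier family AGREES WITH THE BUNDLE OF RECORD on the runs whose selected step is a printed step, and carries the leaf elsewhere (closer: the degenerate carrier)
    (hW : ∀ P : B12.RunParams, lamW.kSel P < P.K → W₀ P = WOfRecord₁₃ F N (Θ.liveRepin₁₃ F N) lamW P) (hWdeg : ∀ P : B12.RunParams, P.K ≤ lamW.kSel P → B15Leaf (W₀ P))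
    (hC : w.C = (datumOfRecord₁₃SepCoP F N (Θ.liveRepin₁₃ F N) hP).C) (hγ : 0 < w.γ ∧ w.γ ≤ (Θ.liveRepin₁₃ F N).γ) (hL : w.L = ((Θ.liveRepin₁₃ F N).L : ℝ))
    (hup : ∀ P, w.up P = upOfRecord₅C F N ((((((Θ.liveRepin₁₃ F N).toStage5₁₃CoP F N).pinB10 F N).pinY F N (Y9OfRecord N (Θ.liveRepin₁₃ F N).toStage3Params Mstar ops)).pinZ F N (Z11OfRecord F N ζ)).pinW F N W₀) P)
    (h05 : ∀ P : B12.RunParams,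
      B8LeafR ((Θ.liveRepin₁₃ F N).res.X P).d8 ((Θ.liveRepin₁₃ F N).res.X P).L8 ((Θ.liveRepin₁₃ F N).res.X P).C₂ ((Θ.liveRepin₁₃ F N).res.X P).B₁' ((Θ.liveRepin₁₃ F N).res.X P).B₀' ((Θ.liveRepin₁₃ F N).res.X P).B₁ ((Θ.liveRepin₁₃ F N).res.X P).B₂ ((Θ.liveRepin₁₃ F N).res.X P).c₁
        ((Θ.liveRepin₁₃ F N).res.X P).inp8 ((Θ.liveRepin₁₃ F N).res.X P).B₀β ((Θ.liveRepin₁₃ F N).res.X P).loc8 ((Θ.liveRepin₁₃ F N).res.X P).fam8R ((Θ.liveRepin₁₃ F N).res.X P).lan8 ((Θ.liveRepin₁₃ F N).res.X P).cub8 ((Θ.liveRepin₁₃ F N).res.X P).toAxial8)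
    (h06 : B9LeafX (Y9OfRecord N (Θ.liveRepin₁₃ F N).toStage3Params Mstar ops))
    (h07 : B11Leaf (Z11OfRecord F N ζ))
    (h08 : PrintedUV3V N (Θ.liveRepin₁₃ F N).L)
    (h09 : ∀ P : B12.RunParams, B12Sec2to5.Lemma4Printed ((Θ.liveRepin₁₃ F N).res.X P).F12 ((Θ.liveRepin₁₃ F N).res.X P).c12)
    (h09T : ∀ P : B12.RunParams, (leavesP w P).smallCouplings → (leavesP w P).smallFieldInductive)
    (h10 : ∀ P : B12.RunParams, B9LeafX (Y9OfRecord N (Θ.liveRepin₁₃ F N).toStage3Params Mstar ops) →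
      (B10.Thm1PrintedCompact (((((((Θ.liveRepin₁₃ F N).toStage5₁₃CoP F N).pinB10 F N).pinY F N (Y9OfRecord N (Θ.liveRepin₁₃ F N).toStage3Params Mstar ops)).pinZ F N (Z11OfRecord F N ζ)).pinW F N W₀).res.X P).runs10 ∧
          B10.Thm2Printed (((((((Θ.liveRepin₁₃ F N).toStage5₁₃CoP F N).pinB10 F N).pinY F N (Y9OfRecord N (Θ.liveRepin₁₃ F N).toStage3Params Mstar ops)).pinZ F N (Z11OfRecord F N ζ)).pinW F N W₀).res.X P).runs10) →
        B11Leaf (Z11OfRecord F N ζ) → B12Sec2to5.Lemma4Printed ((Θ.liveRepin₁₃ F N).res.X P).F12 ((Θ.liveRepin₁₃ F N).res.X P).c12 →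
          B13.Lemma1Printed ((Θ.liveRepin₁₃ F N).res.X P).S13 ((Θ.liveRepin₁₃ F N).res.X P).c13 ∧ B13.Lemma2Printed ((Θ.liveRepin₁₃ F N).res.X P).S13 ((Θ.liveRepin₁₃ F N).res.X P).c13 ∧
            B13.Lemma3Printed ((Θ.liveRepin₁₃ F N).res.X P).S13 ((Θ.liveRepin₁₃ F N).res.X P).c13)
    (h11 : ∀ P : B12.RunParams, (leavesP w P).b7 → (leavesP w P).b8 → (leavesP w P).b9 → (leavesP w P).b10 → (leavesP w P).b11 →
      (leavesP w P).smallCouplings → (leavesP w P).smallFieldInductive → (leavesP w P).flowControl →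
        ∀ k, k < P.K → SLaw₁₃CoP F N (Θ.liveRepin₁₃ F N) P k → TLaw₁₃CoP F N (Θ.liveRepin₁₃ F N) P k)
    -- N12's displays, run by run, BELOW THE TORUS ONLY
    (h12pin : ∀ P : B12.RunParams, lamW.kSel P < P.K → lamW.D1100 P
      = rPrimeDataOfSel (reprTOfRecord₁₃ F N (Θ.liveRepin₁₃ F N) P (lamW.kSel P))
          ((Θ.liveRepin₁₃ F N).ppSel P (gOfRecord₁₃ F N (Θ.liveRepin₁₃ F N) P) (lamW.kSel P + 1))
          (fibOfSeq F (Θ.liveRepin₁₃ F N).ν (Θ.liveRepin₁₃ F N).τ9 P (gOfRecord₁₃ F N (Θ.liveRepin₁₃ F N) P) (lamW.kSel P + 1)))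
    (h12mass : ∀ P : B12.RunParams, lamW.kSel P < P.K → ∀ s, LiveSeq F N Θ.ν Θ.τ9 P (gOfRecord₁₃ F N (Θ.liveRepin₁₃ F N) P) (lamW.kSel P + 1)
        (slotsTOfRecord F N Θ.ν Θ.τ9 (EOfRecord₁₃ F N (Θ.liveRepin₁₃ F N)) (wOfRecord₉ F N (Θ.liveRepin₁₃ F N).toStage9Params)
          (Θ.liveRepin₁₃ F N).ppSel P (gOfRecord₁₃ F N (Θ.liveRepin₁₃ F N) P) (lamW.kSel P + 1)) s →
      0 < ∫ V, rterm (reprTOfRecord₁₃ F N (Θ.liveRepin₁₃ F N) P (lamW.kSel P)) s V ∂(fieldMeasure (F.P P.K) (lamW.kSel P + 1) (SU N)))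
    (h12P1 : ∀ P : B12.RunParams, lamW.kSel P < P.K → Prop1Printed (lamW.LF P))
    (h12i180 : ∀ P : B12.RunParams, lamW.kSel P < P.K → ∀ U, new189 (lamW.D189 P) U → ∀ i, (lamW.D189 P).h ≤ i → i ≤ (lamW.D189 P).k →
      ∀ q ∈ plaqsOf (dom (lamW.D189 P) i),
        Ineq180 ((lamW.D189 P).dev0 U q) ((lamW.D189 P).ε (lamW.D189 P).k) (lamW.D189 P).η (lamW.D189 P).B₃ (lamW.D189 P).B₅ (lamW.D189 P).M (lamW.D189 P).δ
          ((lamW.D189 P).dist q) (lamW.D189 P).O1)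
    (h12c189 : ∀ P : B12.RunParams, lamW.kSel P < P.K → Claim189 (new189 (lamW.D189 P)) (chiPP (lamW.D189 P)))
    (hUV : ∀ P : B12.RunParams, (genFlow (betaOfRecord₁₃ F N (Θ.liveRepin₁₃ F N)) P.g0).InInterval w.γ P.K → ∀ k, k ≤ P.K → SLaw₁₃CoP F N (Θ.liveRepin₁₃ F N) P k →
      ∀ U : GaugeField (F.P P.K) k (SU N),
        chiβOfRecord₁₃ F N (Θ.liveRepin₁₃ F N) P.K (gOfRecord₁₃ F N (Θ.liveRepin₁₃ F N) P) k U *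
              Real.exp (-(1 / (gOfRecord₁₃ F N (Θ.liveRepin₁₃ F N) P k) ^ 2 * wilsonBGOfRecord F N (Θ.liveRepin₁₃ F N).εbg P k U)
                - w.em (gOfRecord₁₃ F N (Θ.liveRepin₁₃ F N) P k) * (Fintype.card (Site (F.P P.K) k) : ℝ)) ≤ densOfRecord₁₃ F N (Θ.liveRepin₁₃ F N) P k U ∧
        densOfRecord₁₃ F N (Θ.liveRepin₁₃ F N) P k U ≤ Real.exp (w.ep (gOfRecord₁₃ F N (Θ.liveRepin₁₃ F N) P k) * (Fintype.card (Site (F.P P.K) k) : ℝ)))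
    (hsel : ∀ P : B12.RunParams, 1 ≤ P.K → lamW.kSel P < P.K) :
    ∃ (θ' : Stage13Params F N) (h' : θ'.Provisos₁₃SepCoP F N) (w' : WorldP), (θ'.ZtUnity F N ∧ θ'.SlotsNondegenerate₁₃ F N) ∧ θ'.Admissible F N ∧
      IsRecordOfRecord₁₃CSepCoP F N (datumOfRecord₁₃SepCoP F N θ' h') w' ∧ (∀ P : B12.RunParams, Nodes (leavesP w' P)) ∧ PrintedUV3V N θ'.L ∧
      ∃ lam : ResidW F N, (∀ P : B12.RunParams, 1 ≤ P.K → lam.kSel P < P.K) ∧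
        ∀ P : B12.RunParams, lam.kSel P < P.K → ((leavesP w' P).rBasicStep ↔ B15Leaf (WOfRecord₁₃ F N θ' lam P)) := by
  obtain ⟨-, hn⟩ := N24_nodes₁₃B10YZW₀_pointed_coP (Θ.liveRepin₁₃ F N) hP.toCore hθ.liveRepin₁₃ Mstar ops ζ W₀ w hC hγ hL hup h05 h06 h07 h08 h09 h09T h10 h11
    (fun P => by
      by_cases hk : lamW.kSel P < P.K
      · rw [hW P hk]
        exact b15Leaf_WOfRecord₁₃_liveRepin₁₃_of_massLive_of_hasResiduals Θ lamW hres hk (h12pin P hk) (h12mass P hk) (h12P1 P hk) (h12i180 P hk) (h12c189 P hk)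
      · exact hWdeg P (not_lt.1 hk))
    (fun P => laws₁₃CoP_liveRepin₁₃_of_hasResiduals F N Θ P hres hθ hκ hE₀ hB₀) hUV
  exact ⟨(Θ.liveRepin₁₃ F N), hP, w, ⟨Stage13Params.ZtUnity.liveRepin₁₃ hres.ztUnity, Stage13Params.slotsNondegenerate₁₃_liveRepin_of_hasResiduals hres⟩, hθ.liveRepin₁₃,
    N24_isRecordOfRecord₁₃CSepCoP_of_up_pinB10YZW₀ (Θ.liveRepin₁₃ F N) hP hθ.liveRepin₁₃ Mstar ops ζ W₀ w hC hγ hL hup, hn, h08,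
    lamW, hsel, fun P hk => by
      rw [← hW P hk]
      show (w.up P).rBasicStep ↔ _
      rw [hup P]
      exact Iff.rfl⟩

end Live

/-! ## §2. At the plan's `L`-keyed witness `θ₁₅ᶜ = theta13OfThm1C F N ε₀ ε₂₉ B₃ a₀ a₁` -/

section Witness
variable (ε₀ ε₂₉ B₃ a₀ a₁ : ℝ) (lamW : ResidW F N)

/-- **★★★ THE v3 RUNG BODY `NodesAtSomeRecord13PW` AT THE PLAN's `L`-KEYED WITNESS `θ₁₅ᶜ = theta13OfThm1C F N ε₀ ε₂₉ B₃ a₀ a₁` OVER THE GENERIC-`W₀` FOUR-PIN VIEW, N12 AND N13 RESOLVED** — §1's rung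
body at `Θ := theta13OfNumerics … (stage12NumericsOfThm1C …) …` (live re-pin = `θ₁₅ᶜ` by `rfl`; K0b's residuals, admissibility and the three signs by node00-def-K0a ∕ dag-n11-e as in 12R §2).
K1⁵-SIDE INPUT: `hP : Provisos₁₃SepCoP θ₁₅ᶜ` ALONE; the layer `lamW`, its selector bound `hsel`, the mixed pin and N12's per-run displays as in §1.  COMPOSITE: nothing discharged as a node. [cite: Balaban1989LargeFieldII, Thm 1 p.355, (0.1) pp.355–356, p.391; Balaban1989LargeFieldI, (0.1) p.175, (0.2)–(0.6) p.176, p.177 (i)–(ii), Prop. 1 (1.78) p.194, (1.80) p.195, (1.89) p.198, (1.99)–(1.102) pp.200–201; Balaban1988Convergent, p.244, (3.16)–(3.25) pp.268–270; Balaban1985UV3, Thm 1 p.257, Thm 2 p.272 (bookkeeping)] -/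
theorem nodesAtSomeRecord₁₃SepCoPPW_of_fourPinW₀_theta13OfThm1C_of_massLive
    (hε : 0 < ε₀) (hε' : 0 < ε₂₉) (hB : 0 ≤ B₃) (ha₀ : 0 < a₀) (ha₁ : 0 < a₁)
    (hP : (theta13OfThm1C F N ε₀ ε₂₉ B₃ a₀ a₁).Provisos₁₃SepCoP F N)
    (Mstar : ℕ) (ops : OpsY N (theta13OfThm1C F N ε₀ ε₂₉ B₃ a₀ a₁).toStage3Params Mstar) (ζ : ResidZ F N) (W₀ : B12.RunParams → PrintedCarriers15) (w : WorldP)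
    -- the generic [IV] carrier family AGREES WITH THE BUNDLE OF RECORD on the runs whose selected step is a printed step, and carries the leaf elsewhere (closer: the degenerate carrier)
    (hW : ∀ P : B12.RunParams, lamW.kSel P < P.K → W₀ P = WOfRecord₁₃ F N (theta13OfThm1C F N ε₀ ε₂₉ B₃ a₀ a₁) lamW P) (hWdeg : ∀ P : B12.RunParams, P.K ≤ lamW.kSel P → B15Leaf (W₀ P))
    (hC : w.C = (datumOfRecord₁₃SepCoP F N (theta13OfThm1C F N ε₀ ε₂₉ B₃ a₀ a₁) hP).C) (hγ : 0 < w.γ ∧ w.γ ≤ (theta13OfThm1C F N ε₀ ε₂₉ B₃ a₀ a₁).γ) (hL : w.L = ((theta13OfThm1C F N ε₀ ε₂₉ B₃ a₀ a₁).L : ℝ))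
    (hup : ∀ P, w.up P = upOfRecord₅C F N ((((((theta13OfThm1C F N ε₀ ε₂₉ B₃ a₀ a₁).toStage5₁₃CoP F N).pinB10 F N).pinY F N (Y9OfRecord N (theta13OfThm1C F N ε₀ ε₂₉ B₃ a₀ a₁).toStage3Params Mstar ops)).pinZ F N (Z11OfRecord F N ζ)).pinW F N W₀) P)
    (h05 : ∀ P : B12.RunParams,
      B8LeafR ((theta13OfThm1C F N ε₀ ε₂₉ B₃ a₀ a₁).res.X P).d8 ((theta13OfThm1C F N ε₀ ε₂₉ B₃ a₀ a₁).res.X P).L8 ((theta13OfThm1C F N ε₀ ε₂₉ B₃ a₀ a₁).res.X P).C₂ ((theta13OfThm1C F N ε₀ ε₂₉ B₃ a₀ a₁).res.X P).B₁' ((theta13OfThm1C F N ε₀ ε₂₉ B₃ a₀ a₁).res.X P).B₀' ((theta13OfThm1C F N ε₀ ε₂₉ B₃ a₀ a₁).res.X P).B₁ ((theta13OfThm1C F N ε₀ ε₂₉ B₃ a₀ a₁).res.X P).B₂ ((theta13OfThm1C F N ε₀ ε₂₉ B₃ a₀ a₁).res.X P).c₁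
        ((theta13OfThm1C F N ε₀ ε₂₉ B₃ a₀ a₁).res.X P).inp8 ((theta13OfThm1C F N ε₀ ε₂₉ B₃ a₀ a₁).res.X P).B₀β ((theta13OfThm1C F N ε₀ ε₂₉ B₃ a₀ a₁).res.X P).loc8 ((theta13OfThm1C F N ε₀ ε₂₉ B₃ a₀ a₁).res.X P).fam8R ((theta13OfThm1C F N ε₀ ε₂₉ B₃ a₀ a₁).res.X P).lan8 ((theta13OfThm1C F N ε₀ ε₂₉ B₃ a₀ a₁).res.X P).cub8 ((theta13OfThm1C F N ε₀ ε₂₉ B₃ a₀ a₁).res.X P).toAxial8)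
    (h06 : B9LeafX (Y9OfRecord N (theta13OfThm1C F N ε₀ ε₂₉ B₃ a₀ a₁).toStage3Params Mstar ops))
    (h07 : B11Leaf (Z11OfRecord F N ζ))
    (h08 : PrintedUV3V N (theta13OfThm1C F N ε₀ ε₂₉ B₃ a₀ a₁).L)
    (h09 : ∀ P : B12.RunParams, B12Sec2to5.Lemma4Printed ((theta13OfThm1C F N ε₀ ε₂₉ B₃ a₀ a₁).res.X P).F12 ((theta13OfThm1C F N ε₀ ε₂₉ B₃ a₀ a₁).res.X P).c12)
    (h09T : ∀ P : B12.RunParams, (leavesP w P).smallCouplings → (leavesP w P).smallFieldInductive)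
    (h10 : ∀ P : B12.RunParams, B9LeafX (Y9OfRecord N (theta13OfThm1C F N ε₀ ε₂₉ B₃ a₀ a₁).toStage3Params Mstar ops) →
      (B10.Thm1PrintedCompact (((((((theta13OfThm1C F N ε₀ ε₂₉ B₃ a₀ a₁).toStage5₁₃CoP F N).pinB10 F N).pinY F N (Y9OfRecord N (theta13OfThm1C F N ε₀ ε₂₉ B₃ a₀ a₁).toStage3Params Mstar ops)).pinZ F N (Z11OfRecord F N ζ)).pinW F N W₀).res.X P).runs10 ∧
          B10.Thm2Printed (((((((theta13OfThm1C F N ε₀ ε₂₉ B₃ a₀ a₁).toStage5₁₃CoP F N).pinB10 F N).pinY F N (Y9OfRecord N (theta13OfThm1C F N ε₀ ε₂₉ B₃ a₀ a₁).toStage3Params Mstar ops)).pinZ F N (Z11OfRecord F N ζ)).pinW F N W₀).res.X P).runs10) →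
        B11Leaf (Z11OfRecord F N ζ) → B12Sec2to5.Lemma4Printed ((theta13OfThm1C F N ε₀ ε₂₉ B₃ a₀ a₁).res.X P).F12 ((theta13OfThm1C F N ε₀ ε₂₉ B₃ a₀ a₁).res.X P).c12 →
          B13.Lemma1Printed ((theta13OfThm1C F N ε₀ ε₂₉ B₃ a₀ a₁).res.X P).S13 ((theta13OfThm1C F N ε₀ ε₂₉ B₃ a₀ a₁).res.X P).c13 ∧ B13.Lemma2Printed ((theta13OfThm1C F N ε₀ ε₂₉ B₃ a₀ a₁).res.X P).S13 ((theta13OfThm1C F N ε₀ ε₂₉ B₃ a₀ a₁).res.X P).c13 ∧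
            B13.Lemma3Printed ((theta13OfThm1C F N ε₀ ε₂₉ B₃ a₀ a₁).res.X P).S13 ((theta13OfThm1C F N ε₀ ε₂₉ B₃ a₀ a₁).res.X P).c13)
    (h11 : ∀ P : B12.RunParams, (leavesP w P).b7 → (leavesP w P).b8 → (leavesP w P).b9 → (leavesP w P).b10 → (leavesP w P).b11 →
      (leavesP w P).smallCouplings → (leavesP w P).smallFieldInductive → (leavesP w P).flowControl →
        ∀ k, k < P.K → SLaw₁₃CoP F N (theta13OfThm1C F N ε₀ ε₂₉ B₃ a₀ a₁) P k → TLaw₁₃CoP F N (theta13OfThm1C F N ε₀ ε₂₉ B₃ a₀ a₁) P k)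
    -- N12's displays, run by run, BELOW THE TORUS ONLY
    (h12pin : ∀ P : B12.RunParams, lamW.kSel P < P.K → lamW.D1100 P
      = rPrimeDataOfSel (reprTOfRecord₁₃ F N (theta13OfThm1C F N ε₀ ε₂₉ B₃ a₀ a₁) P (lamW.kSel P))
          ((theta13OfThm1C F N ε₀ ε₂₉ B₃ a₀ a₁).ppSel P (gOfRecord₁₃ F N (theta13OfThm1C F N ε₀ ε₂₉ B₃ a₀ a₁) P) (lamW.kSel P + 1))
          (fibOfSeq F (theta13OfThm1C F N ε₀ ε₂₉ B₃ a₀ a₁).ν (theta13OfThm1C F N ε₀ ε₂₉ B₃ a₀ a₁).τ9 P (gOfRecord₁₃ F N (theta13OfThm1C F N ε₀ ε₂₉ B₃ a₀ a₁) P) (lamW.kSel P + 1)))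
    (h12mass : ∀ P : B12.RunParams, lamW.kSel P < P.K → ∀ s, LiveSeq F N (theta13OfThm1C F N ε₀ ε₂₉ B₃ a₀ a₁).ν (theta13OfThm1C F N ε₀ ε₂₉ B₃ a₀ a₁).τ9 P (gOfRecord₁₃ F N (theta13OfThm1C F N ε₀ ε₂₉ B₃ a₀ a₁) P) (lamW.kSel P + 1)
        (slotsTOfRecord F N (theta13OfThm1C F N ε₀ ε₂₉ B₃ a₀ a₁).ν (theta13OfThm1C F N ε₀ ε₂₉ B₃ a₀ a₁).τ9 (EOfRecord₁₃ F N (theta13OfThm1C F N ε₀ ε₂₉ B₃ a₀ a₁)) (wOfRecord₉ F N (theta13OfThm1C F N ε₀ ε₂₉ B₃ a₀ a₁).toStage9Params)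
          (theta13OfThm1C F N ε₀ ε₂₉ B₃ a₀ a₁).ppSel P (gOfRecord₁₃ F N (theta13OfThm1C F N ε₀ ε₂₉ B₃ a₀ a₁) P) (lamW.kSel P + 1)) s →
      0 < ∫ V, rterm (reprTOfRecord₁₃ F N (theta13OfThm1C F N ε₀ ε₂₉ B₃ a₀ a₁) P (lamW.kSel P)) s V ∂(fieldMeasure (F.P P.K) (lamW.kSel P + 1) (SU N)))
    (h12P1 : ∀ P : B12.RunParams, lamW.kSel P < P.K → Prop1Printed (lamW.LF P))
    (h12i180 : ∀ P : B12.RunParams, lamW.kSel P < P.K → ∀ U, new189 (lamW.D189 P) U → ∀ i, (lamW.D189 P).h ≤ i → i ≤ (lamW.D189 P).k →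
      ∀ q ∈ plaqsOf (dom (lamW.D189 P) i),
        Ineq180 ((lamW.D189 P).dev0 U q) ((lamW.D189 P).ε (lamW.D189 P).k) (lamW.D189 P).η (lamW.D189 P).B₃ (lamW.D189 P).B₅ (lamW.D189 P).M (lamW.D189 P).δ
          ((lamW.D189 P).dist q) (lamW.D189 P).O1)
    (h12c189 : ∀ P : B12.RunParams, lamW.kSel P < P.K → Claim189 (new189 (lamW.D189 P)) (chiPP (lamW.D189 P)))
    (hUV : ∀ P : B12.RunParams, (genFlow (betaOfRecord₁₃ F N (theta13OfThm1C F N ε₀ ε₂₉ B₃ a₀ a₁)) P.g0).InInterval w.γ P.K → ∀ k, k ≤ P.K → SLaw₁₃CoP F N (theta13OfThm1C F N ε₀ ε₂₉ B₃ a₀ a₁) P k →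
      ∀ U : GaugeField (F.P P.K) k (SU N),
        chiβOfRecord₁₃ F N (theta13OfThm1C F N ε₀ ε₂₉ B₃ a₀ a₁) P.K (gOfRecord₁₃ F N (theta13OfThm1C F N ε₀ ε₂₉ B₃ a₀ a₁) P) k U *
              Real.exp (-(1 / (gOfRecord₁₃ F N (theta13OfThm1C F N ε₀ ε₂₉ B₃ a₀ a₁) P k) ^ 2 * wilsonBGOfRecord F N (theta13OfThm1C F N ε₀ ε₂₉ B₃ a₀ a₁).εbg P k U)
                - w.em (gOfRecord₁₃ F N (theta13OfThm1C F N ε₀ ε₂₉ B₃ a₀ a₁) P k) * (Fintype.card (Site (F.P P.K) k) : ℝ)) ≤ densOfRecord₁₃ F N (theta13OfThm1C F N ε₀ ε₂₉ B₃ a₀ a₁) P k U ∧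
        densOfRecord₁₃ F N (theta13OfThm1C F N ε₀ ε₂₉ B₃ a₀ a₁) P k U ≤ Real.exp (w.ep (gOfRecord₁₃ F N (theta13OfThm1C F N ε₀ ε₂₉ B₃ a₀ a₁) P k) * (Fintype.card (Site (F.P P.K) k) : ℝ)))
    (hsel : ∀ P : B12.RunParams, 1 ≤ P.K → lamW.kSel P < P.K) :
    ∃ (θ' : Stage13Params F N) (h' : θ'.Provisos₁₃SepCoP F N) (w' : WorldP), (θ'.ZtUnity F N ∧ θ'.SlotsNondegenerate₁₃ F N) ∧ θ'.Admissible F N ∧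
      IsRecordOfRecord₁₃CSepCoP F N (datumOfRecord₁₃SepCoP F N θ' h') w' ∧ (∀ P : B12.RunParams, Nodes (leavesP w' P)) ∧ PrintedUV3V N θ'.L ∧
      ∃ lam : ResidW F N, (∀ P : B12.RunParams, 1 ≤ P.K → lam.kSel P < P.K) ∧
        ∀ P : B12.RunParams, lam.kSel P < P.K → ((leavesP w' P).rBasicStep ↔ B15Leaf (WOfRecord₁₃ F N θ' lam P)) :=
  nodesAtSomeRecord₁₃SepCoPPW_of_fourPinW₀_liveRepin₁₃_of_massLive_of_hasResiduals
    (theta13OfNumerics F N (stage12NumericsOfThm1C F.L ε₀ B₃ a₀ a₁) ε₂₉ (zeta316OfRecord F N (stage12NumericsOfThm1C F.L ε₀ B₃ a₀ a₁).ν (stage12NumericsOfThm1C F.L ε₀ B₃ a₀ a₁).τ9.M (stage12NumericsOfThm1C F.L ε₀ B₃ a₀ a₁).A₁) (RzOfRecord F N) (ZtOfRecord F N)) lamW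
    (hasResidualsOfRecord_theta13OfNumerics F N (stage12NumericsOfThm1C F.L ε₀ B₃ a₀ a₁) ε₂₉) hP
    (admissible_theta13OfNumerics F N (zeta316OfRecord F N (stage12NumericsOfThm1C F.L ε₀ B₃ a₀ a₁).ν (stage12NumericsOfThm1C F.L ε₀ B₃ a₀ a₁).τ9.M (stage12NumericsOfThm1C F.L ε₀ B₃ a₀ a₁).A₁) (RzOfRecord F N) (ZtOfRecord F N) (stage12NumericsOfThm1C_pos hε hB ha₀ ha₁) hε')
    (kappa_nonneg_theta13OfThm1C F N ε₀ ε₂₉ B₃ a₀ a₁) (E0_nonneg_theta13OfThm1C F N ε₀ ε₂₉ B₃ a₀ a₁) (B0_nonneg_theta13OfThm1C F N ε₀ ε₂₉ B₃ a₀ a₁)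
    Mstar ops ζ W₀ w hW hWdeg hC hγ hL hup h05 h06 h07 h08 h09 h09T h10 h11 h12pin h12mass h12P1 h12i180 h12c189 hUV hsel

end Witness

end Summit.QuantumFields.YangMills.BalabanUVNodes.N12AtRecord13SepCoPSocketsPW
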